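import Literature.NumberTheory.EllipticCurves.Kobayashi2003.CyclotomicTowerSignedSelmer
import Mathlib.NumberTheory.Cyclotomic.Basic
import HarnessLib

/-!
# Kobayashi 2003, Def. 2.1 / Thm. 2.2 — the WHOLE Pontryagin dual `X^±(E/K_∞)` over the tower
# `K_∞ = ℚ(μ_{p^∞})` as a `ℤ_p[[Γ]]`-module (hypothesis structure, the printed object), and Thm. 2.2
# read on it (named fact: finitely generated and torsion over `ℤ_p[[Γ]]`)

Topic `Literature/NumberTheory/EllipticCurves`, cluster `Kobayashi2003` (namespace = path). Sequel of
`CyclotomicTowerSignedSelmer.lean` (the OBJECTS over Kobayashi's tower `K_n = ℚ(ζ_{p^{n+1}})`: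
`towerSignedSelmerInfty = Sel^ε(E/K_∞)`, its `η`-components `towerSignedSelmerInftyEta`, and the
Pontryagin-dual datum `EtaSignedSelmerDualData` of ONE `η`-COMPONENT, §7 there). THIS FILE adds the
dual datum of the WHOLE group `Sel^ε(E/K_∞)` — the object about which Kobayashi's Thm. 2.2 and
Kitajima–Otsuki's Main Thm. 1.3 (`F = ℚ`) are PRINTED — and Thm. 2.2 on it as a named fact.
Cell `bsd-cm` (run/shared/lean/pub/bsd-cm/), seat `bsd-cm-k8i-ty` (D-0074 group (G), typer), K8 route
`InertBadSignedBranches`, item stmt-BirchSwinnertonDyer-19226 `PrintReadingsInert`, conjunct 2, reading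
(R2) `Additive.OddBranchStrictMinusNoFiniteSubmoduleAt`; equally cell `bsd-potss`, K8-Gss2 crux (R2±)
`NoFiniteSubmoduleSigned` (items 19117 / 19222 / 19233). HONEST FRAMING (cell bsd-cm): the programme
assembles BSD for analytic-rank `≤ 1` curves strictly from published theorems and TYPES the remainder;
BSD is not proved by any of this. ONE hypothesis structure (definition with a body; nothing asserted)
and ONE named fact (`def … : Prop`, D-0014; no `_holds`).

WHY. Until now the Literature carried Kitajima–Otsuki's theorem only (a) over the base `F_0 = ℚ(μ_p)`
for the sign `+` on Def. 1.1's object without the `m = −1` clause (`PlusSelmerNoFiniteSubmodule.lean`)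
and (b) on the `η`-COMPONENTS of the tower object for both signs (`EtaSelmerNoFiniteSubmodule.lean`),
the latter under the reading flag `KO18-eta-summand` ("the print is for `X^±(F_∞)` WHOLE; an `η`-part
is a direct summand"). The summand step has since been RUN IN THE KERNEL Summits-side (cell
`bsd-potss`, `Summits/…/Rank1Residual/Additive/CyclotomicTowerSignedSelmerEtaSummand.lean`,
`EtaSignedSelmerDualData.forall_finite_eq_bot_of_tower`, on a structure `Additive.TowerSignedSelmerDualData`
with exactly the fields below), so what is missing for a flag-free (R2)/(R2±) is the named fact IN THE
PRINTED SHAPE — on the whole dual — homed in the Literature; that needs the whole-dual datum in the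
Literature first, which is this file (the structure is FIELD FOR FIELD the Summits one, over the
Literature-homed objects of `CyclotomicTowerSignedSelmer.lean`, whose bodies are identical to the
Summits originals, so a Theorems-side transport between the two structures is by `rfl` on every field,
exactly as for `EtaSignedSelmerDualData`). The Kitajima–Otsuki fact itself is the sibling file
`KitajimaOtsuki2018/TowerSignedSelmerNoFiniteSubmodule.lean`.

## Source, verbatim (S. Kobayashi, Invent. Math. 152 (2003) 1–36, held text
## `paper:doi-10-1007-s00222-002-0265-4`, pp. 4, 5, 8)

p. 4: "Let `p` be an odd prime number. … We denote `K_n = ℚ(ζ_{p^{n+1}})`, `K_{−1} = ℚ` and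
`K_∞ = ∪_n K_n`. Let `E` be an elliptic curve over `ℚ` with good reduction at `p`. We assume that
`a_p = 0`." p. 5, **Definition 2.1**: "The even (odd) Selmer group is defined by `Sel^±(E/K_n) :=
Ker( H¹(K_n, E[p^∞]) → ∏_v H¹(K_{n,v}, E[p^∞]) / E^±(K_{n,v}) ⊗ ℚ_p/ℤ_p )` and `Sel^±(E/K_∞) :=
lim→_n Sel^±(E/K_n)`. … We denote the Pontryagin dual of Selmer groups by “`X`”. … `X^±(E/K_∞)` is
the dual of `Sel^±(E/K_∞)`. Let `G_n = Gal(K_n/ℚ)` and `G_∞ = lim← G_n`. Then `Λ_n = ℤ_p[G_n]` acts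
naturally on `X^±(E/K_n)` and `Λ = ℤ_p[[G_∞]]` on `X^±(E/K_∞)`. **Theorem 2.2.** The Pontryagin dual
of the even (odd) Selmer group `X^±(E/K_∞)` is a finitely generated torsion `Λ`-module." p. 5 (§3):
"`G_∞ = Δ × Γ`, where `Δ ≅ ℤ/(p−1)ℤ` and `Γ ≅ ℤ_p`. We fix a topological generator `γ ∈ Γ`. Then we
identify `ℤ_p[[Γ]]` with `ℤ_p[[X]]` and `Λ` with `ℤ_p[Δ][[X]]` by identifying `γ` with `1 + X`."
p. 8 (§4): "For a `ℤ_p[Δ]`-module `M`, let `M^η` denote the `η`-component of `M`. If we denote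
`ε_η = (1/♯Δ) ∑_{τ∈Δ} η^{−1}(τ) τ`, `M^η` is given by `ε_η M`. … By Theorem 2.2, `X^±(E/K_∞)^η` is a
torsion `ℤ_p[[Γ]]`-module." Kitajima–Otsuki, arXiv:1607.03612 §4 (p. 18; = Tokyo J. Math. 41 (2018)):
"Let `Γ = Gal(F_∞/F_0)` and `Λ = ℤ_p[[Γ]]`. We fix a topological generator `γ ∈ Γ`. Then we identify
… `ℤ_p[[Γ]]` with … `ℤ_p[[X]]` by identifying `γ` with `1 + X`" (`F_0 = ℚ(μ_p)`, `F_∞ = ℚ(μ_{p^∞}) = K_∞`).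

## Content

* §1 `TowerSignedSelmerDualData W κ K₀ E γ ε` — **Pontryagin-dual data for the WHOLE `Sel^ε(E/K_∞)`**
  (`K_∞ = K₀·K_∞^κ`): FIELD FOR FIELD `EtaSignedSelmerDualData` (§7 of the object file) with
  `towerSignedSelmerInftyEta … η ε ↦ towerSignedSelmerInfty … ε` — an abstract `Λ = ℤ_p⟦T⟧`-module `X`
  with `toDual : X ≃ Hom(Sel^ε(E/K_∞), ℚ/ℤ)`, `T ↔ conj_γ − 1` for `γ ∈ Gal(K̄/K₀)` with `κ γ` a
  topological generator (so `T ↔ γ|_{K_∞} − 1`, `γ|_{K_∞}` a topological generator of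
  `Γ = Gal(K_∞/K₀)`: the printed `ℤ_p[[Γ]] = ℤ_p[[X]]`, `γ ↔ 1 + X`), constants through `ℤ_p → ℤ/p^k`;
  `conj_mem` is dischargeable by `conjH1_mem_towerSignedSelmerInfty`. The structure projections are
  registered as instances on the new type `D.X` (`attribute [instance]`, as for `SelmerDualData`);
  `charIdeal`, `mu`, `lambda` (junk `0` off the finitely generated torsion case, as everywhere in the
  tree); `toDualEquiv`. For
  `K = ℚ`, `κ` cyclotomic, `K₀ = ℚ(μ_p)`, `E = ℚ_[p]`: Kobayashi's `X^±(E/K_∞)` WITH ITS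
  `ℤ_p[[Γ]]`-STRUCTURE (the `Δ`-action — hence the full `Λ = ℤ_p[Δ][[X]]`-structure — is not part of the
  datum; it is not needed to STATE Thm. 2.2 / Main Thm. 1.3 in their `ℤ_p[[Γ]]`-readings, see §2).
  NOTHING about existence, finite generation, torsion or finite submodules is asserted by the
  structure. (Existence = the `IsLocNil.module` construction on `Hom(Sel^ε(E/K_∞), ℚ/ℤ)`; done
  Summits-side for the field-identical original, `Additive.towerSignedSelmerDualData`; not repeated here.)
* §2 `thm22_towerSignedSelmerDual_finite_torsion` — **Thm. 2.2 for the WHOLE `X^ε(E/K_∞)`, read over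
  `ℤ_p[[Γ]]`** (named fact, both signs): `K = ℚ`, `K₀ = ℚ(μ_p)` (`IsCyclotomicExtension {p} ℚ K₀`), `V/ℚ`
  globally minimal with good reduction at the odd `p` and `a_p = 0`, `κ` the cyclotomic `ℤ_p`-extension
  with a topological generator `γ ∈ Gal(ℚ̄/K₀)`, ANY datum `D`: `D.X` is finitely generated and torsion
  over `ℤ_p⟦T⟧`. READING (one line, recorded not hidden): the print is "finitely generated torsion
  `Λ`-module", `Λ = ℤ_p[Δ][[X]] ⊇ ℤ_p[[Γ]] = ℤ_p[[X]]`; `Λ` is free of rank `♯Δ = p − 1` over `ℤ_p[[Γ]]`,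
  so finitely generated over `Λ` ⟹ finitely generated over `ℤ_p[[Γ]]`, and — `μ_{p−1} ⊂ ℤ_p^×`, so
  `Λ = ∏_η ε_η Λ ≅ ∏_η ℤ_p[[X]]` and `X = ⊕_η X^η` — `Λ`-torsion means every `X^η` is `ℤ_p[[X]]`-torsion,
  which is how the author himself reads Thm. 2.2 on p. 8 ("By Theorem 2.2, `X^±(E/K_∞)^η` is a torsion
  `ℤ_p[[Γ]]`-module"), i.e. `X` is `ℤ_p[[Γ]]`-torsion. Both clauses are therefore implied by (never
  stronger than) the print. The `η`-COMPONENT reading is the existing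
  `thm22_etaSignedSelmerDual_finite_torsion` (`SignedSelmerEtaComponentFacts.lean`); this is the
  whole-module companion (it is hypothesis (vi) of Kitajima–Otsuki's Main Thm. 1.3 for `F = ℚ`, "discharged
  in print" by their §2 p. 6 / Remark 1.4 (5) pointing to this very theorem).

## What is NOT here

The `Δ`-action on the datum and the splitting `X = ⊕_η X^η` (Summits-side:
`Additive/CyclotomicTowerSignedSelmerEtaAverage.lean`, `…EtaSummand.lean`); existence of a datum
(Summits-side, see above); Thm. 4.1 / the main conjectures / Thm. 7.4 for the whole `X^±` (their
`p`-adic `L`-functions over the full `Λ = ℤ_p[Δ][[X]]` are not typed; the `η`-branch statements are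
`SignedSelmerEtaComponentFacts.lean`); Kitajima–Otsuki's theorem (sibling file); any proof. No
`instance` declaration (only the structure-projection attributes on the new type `D.X`); no notation.

References: [Kobayashi2003] S. Kobayashi, Invent. Math. 152 (2003) 1–36: §2 p. 4, Def. 2.1 and
Thm. 2.2 (p. 5), §3 p. 5 (`G_∞ = Δ × Γ`, `γ ↔ 1 + X`), §4 p. 8 (`M^η = ε_η M`; "By Theorem 2.2,
`X^±(E/K_∞)^η` is a torsion `ℤ_p[[Γ]]`-module"), Thm. 7.3 (ii) (p. 28, the proof of Thm. 2.2);
[KitajimaOtsuki2018] T. Kitajima, R. Otsuki, Tokyo J. Math. 41 (2018) 273–303 = arXiv:1607.03612: §4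
(p. 18: `Λ = ℤ_p[[Γ]]`, `γ ↔ 1 + X`), §2 p. 6 and Remark 1.4 (5) (hypothesis (vi) for `F = ℚ`);
[GreenbergLNM1716] R. Greenberg, LNM 1716 (1999) §1 (p. 60: the dual of a discrete `p`-primary
`Γ`-module as a `Λ`-module).
-/

noncomputable section

open scoped Classical

universe u

namespace Literature.NumberTheory.EllipticCurves.Kobayashi2003

open WeierstrassCurve Field Literature.NumberTheory.EllipticCurves
  Literature.NumberTheory.GaloisRepresentations ZpExtension

/-! ## §1 The Pontryagin dual `X^ε(E/K_∞)` of the WHOLE signed Selmer group as a hypothesis structure -/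

section Dual

variable {K : Type u} [Field K] [NumberField K] {p : ℕ} [Fact p.Prime]

/-- **Pontryagin-dual data for the WHOLE `Sel^ε(E/K_∞)`** (`K_∞ = K₀·K_∞^κ`; Kobayashi: `K = ℚ`,
`K₀ = ℚ(μ_p)`, `K_∞ = ℚ(μ_{p^∞})`) — field for field `EtaSignedSelmerDualData` with the `η`-component
`Sel^ε(E/K_∞)^η` replaced by the whole group: the Iwasawa module `X^ε(E/K_∞) = Hom(Sel^ε(E/K_∞), ℚ_p/ℤ_p)`
("We denote the Pontryagin dual of Selmer groups by “`X`” … `X^±(E/K_∞)` is the dual of `Sel^±(E/K_∞)`",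
Def. 2.1, p. 5) as an abstract `ℤ_p[[Γ]] = ℤ_p⟦T⟧`-module `X` (`IwasawaAlgebra p`), `T ↔ conj_γ − 1`
for `γ ∈ Gal(K̄/K₀)` with `κ γ` a topological generator ("we fix a topological generator `γ ∈ Γ` …
identifying `γ` with `1 + X`", p. 5; Kitajima–Otsuki §4), with: `conj_mem` (stability of
`Sel^ε(E/K_∞)` under `conj_γ`, dischargeable by `conjH1_mem_towerSignedSelmerInfty`), `toDual`
bijective onto the character group `Hom(Sel^ε(E/K_∞), ℚ/ℤ)` (`ℚ/ℤ = AddCircle (1 : ℚ) ⊇ ℚ_p/ℤ_p`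
receives every character of the `p`-primary group), the `T`-axiom `(T·x)(s) = x(conj_γ s) − x(s)` and
the constants axiom (`c ∈ ℤ_p` acts on `p^k`-torsion classes through `ℤ_p → ℤ/p^k`). The `Δ`-action
(hence the full `Λ = ℤ_p[Δ][[X]]`-structure) is NOT part of the datum. NOTHING about existence, finite
generation, torsion (Thm. 2.2) or finite submodules (Kitajima–Otsuki) is asserted. Field-identical to the
Summits-side `Additive.TowerSignedSelmerDualData` (cell `bsd-potss`), over the Literature-homed objects.
[cite: Kobayashi2003, Def. 2.1 and Thm. 2.2 (p. 5), §3 p. 5 (γ ↔ 1 + X) (the object only)]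
[cite: KitajimaOtsuki2018, §4 (Λ = ℤ_p[[Γ]], γ ↔ 1 + X) and Main Thm. 1.3 (arXiv:1607.03612 pp. 18, 3) (the object only)]
[cite: GreenbergLNM1716, §1 (p. 60)] -/
structure TowerSignedSelmerDualData (W : WeierstrassCurve K) (κ : ZpExtension K p)
    (K₀ : Type u) [Field K₀] [NumberField K₀] [Algebra K K₀] [(galRange (K := K) K₀).Normal]
    (E : Type u) [Field E] [Algebra K E] (γ : Field.absoluteGaloisGroup K) (ε : ℤˣ) where
  /-- The underlying type of the Iwasawa module `X^ε(E/K_∞)`. -/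
  X : Type u
  /-- `X` is an abelian group. -/
  [addCommGroup : AddCommGroup X]
  /-- `X` is a `Λ = ℤ_p⟦T⟧`-module. -/
  [module : Module (IwasawaAlgebra p) X]
  /-- `Sel^ε(E/K_∞)` is stable under conjugation by `γ` (holds by
  `conjH1_mem_towerSignedSelmerInfty`). -/
  conj_mem : ∀ s ∈ towerSignedSelmerInfty W κ K₀ E ε,
    W.conjH1 p (towerTopSubgroup κ K₀) γ s ∈ towerSignedSelmerInfty W κ K₀ E ε
  /-- The identification of `X` with the character group `Hom(Sel^ε_∞, ℚ/ℤ)`. -/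
  toDual : X →+ (towerSignedSelmerInfty W κ K₀ E ε →+ AddCircle (1 : ℚ))
  /-- `toDual` is a group isomorphism. -/
  bijective : Function.Bijective toDual
  /-- `T` acts as `γ - 1`: `(T·x)(s) = x(conj_γ s) - x(s)`. -/
  toDual_T_smul : ∀ (x : X) (s : towerSignedSelmerInfty W κ K₀ E ε),
    toDual ((PowerSeries.X : IwasawaAlgebra p) • x) s =
      toDual x ⟨W.conjH1 p (towerTopSubgroup κ K₀) γ s, conj_mem s s.2⟩ - toDual x s
  /-- Constants `c ∈ ℤ_p` act on `pᵏ`-torsion classes through `ℤ_p → ℤ/pᵏ`. -/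
  toDual_C_smul : ∀ (c : ℤ_[p]) (x : X) (s : towerSignedSelmerInfty W κ K₀ E ε) (k : ℕ),
    (p ^ k) • s = 0 → toDual (PowerSeries.C c • x) s = (PadicInt.toZModPow k c).val • toDual x s

namespace TowerSignedSelmerDualData

variable {W : WeierstrassCurve K} {κ : ZpExtension K p} {K₀ : Type u} [Field K₀] [NumberField K₀]
  [Algebra K K₀] [(galRange (K := K) K₀).Normal] {E : Type u} [Field E] [Algebra K E]
  {γ : Field.absoluteGaloisGroup K} {ε : ℤˣ}

-- The structure projections `addCommGroup`, `module` as instances on the NEW type `D.X` (exactly as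
-- `SelmerDualData`, `LambdaAdicSelmerData`, `IwasawaH1Data` do; no library instance is touched).
attribute [instance] TowerSignedSelmerDualData.addCommGroup TowerSignedSelmerDualData.module

variable (D : TowerSignedSelmerDualData W κ K₀ E γ ε)

/-- The **characteristic ideal** `Char(X^ε(E/K_∞)) ⊆ ℤ_p[[Γ]]` (`Module.charIdeal`) — the object of
the main conjectures over the tower (NOT asserted; Kobayashi's `Char` is taken `η`-component by
`η`-component over `ℤ_p[[Γ]]`, §4 p. 8). [cite: Kobayashi2003, Thm. 2.2 (p. 5) and §4 p. 8 (the object only)] -/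
def charIdeal : Ideal (IwasawaAlgebra p) :=
  Literature.NumberTheory.EllipticCurves.Module.charIdeal (IwasawaAlgebra p) D.X

/-- The **`μ`-invariant** of `X^ε(E/K_∞)` over `ℤ_p[[Γ]]` (`muInvariant`; junk `0` unless finitely
generated torsion). [cite: Kobayashi2003, Thm. 2.2 (p. 5) (the object only)] -/
def mu : ℕ :=
  muInvariant p D.X

/-- The **`λ`-invariant** of `X^ε(E/K_∞)` over `ℤ_p[[Γ]]` (`lambdaInvariant`; junk `0` unless finitely
generated torsion). [cite: Kobayashi2003, Thm. 2.2 (p. 5) (the object only)] -/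
def lambda : ℕ :=
  lambdaInvariant p D.X

/-- `toDual` as a group isomorphism `X ≃ Hom(Sel^ε(E/K_∞), ℚ/ℤ)` (`AddEquiv.ofBijective`).
[cite: Kobayashi2003, Def. 2.1 (p. 5) (the object only)] -/
def toDualEquiv : D.X ≃+ (towerSignedSelmerInfty W κ K₀ E ε →+ AddCircle (1 : ℚ)) :=
  AddEquiv.ofBijective D.toDual D.bijective

/-- Unfolding `toDualEquiv`. [cite: Kobayashi2003, Def. 2.1 (p. 5) (the object only)] -/
@[simp] theorem toDualEquiv_apply (x : D.X) : D.toDualEquiv x = D.toDual x := rfl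

/-- A dual element vanishes iff it vanishes as a character of `Sel^ε(E/K_∞)` (`toDual` is injective).
[cite: Kobayashi2003, Def. 2.1 (p. 5) (the object only)] -/
theorem eq_zero_iff_toDual_eq_zero (x : D.X) : x = 0 ↔ D.toDual x = 0 := by
  constructor
  · rintro rfl; exact map_zero _
  · intro h; exact D.bijective.injective (by rw [h, map_zero])

end TowerSignedSelmerDualData

end Dual

/-! ## §2 Theorem 2.2 for the WHOLE `X^ε(E/K_∞)`, read over `ℤ_p[[Γ]]` (named fact) -/

/-- **Kobayashi 2003, Thm. 2.2, on the WHOLE dual `X^ε(E/K_∞)`, read over `ℤ_p[[Γ]]`** (p. 5: "The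
Pontryagin dual of the even (odd) Selmer group `X^±(E/K_∞)` is a finitely generated torsion `Λ`-module",
`Λ = ℤ_p[[G_∞]] = ℤ_p[Δ][[X]]`, `K_∞ = ℚ(μ_{p^∞})`; p. 8 l. 16: "By Theorem 2.2, `X^±(E/K_∞)^η` is a
torsion `ℤ_p[[Γ]]`-module"), BOTH signs `ε`: `K₀ = ℚ(μ_p)` (`IsCyclotomicExtension {p} ℚ K₀`), `V/ℚ`
globally minimal with good reduction at the odd prime `p` and `a_p = 0` (p. 4), `κ` the cyclotomic
`ℤ_p`-extension of `ℚ` with a topological generator `γ ∈ Gal(ℚ̄/K₀)` ("`γ ∈ Γ`"), `D` ANY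
Pontryagin-dual datum of the whole `Sel^ε(V/K_∞)` at the model `ℚ_[p]`: `D.X` is finitely generated
and torsion over `ℤ_p[[Γ]] = ℤ_p⟦T⟧` (`T = γ − 1`). READING (implied by, never stronger than, the
print): `Λ = ℤ_p[Δ][[X]]` is free of rank `p − 1` over `ℤ_p[[Γ]]` and splits as `∏_η ℤ_p[[X]]`
(`μ_{p−1} ⊂ ℤ_p^×`), so "finitely generated torsion over `Λ`" gives both clauses over `ℤ_p[[Γ]]`
(`X = ⊕_η X^η`, each `X^η` `ℤ_p[[Γ]]`-torsion — the author's own reading on p. 8). The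
`η`-component companion is `thm22_etaSignedSelmerDual_finite_torsion`. This is hypothesis (vi) of
Kitajima–Otsuki's Main Thm. 1.3 for `F = ℚ` (their §2 p. 6 / Remark 1.4 (5) cite this theorem for
it). Named fact; nothing asserted; no `_holds`.
[cite: Kobayashi2003, Thm. 2.2 (p. 5), §3 p. 5 (Λ = ℤ_p[Δ][[X]], γ ↔ 1 + X) and §4 p. 8 l. 16]
[cite: KitajimaOtsuki2018, §2 p. 6 and Remark 1.4 (5) (arXiv:1607.03612 pp. 6, 4) (hypothesis (vi) for F = ℚ)] -/
def thm22_towerSignedSelmerDual_finite_torsion : Prop :=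
  ∀ (p : ℕ) [Fact p.Prime] (K₀ : Type) [Field K₀] [NumberField K₀] [IsCyclotomicExtension {p} ℚ K₀]
    [(galRange (K := ℚ) K₀).Normal],
  ∀ (V : WeierstrassCurve ℚ) [V.IsElliptic] [V.IsGloballyMinimal],
    p ≠ 2 → V.HasGoodReductionAtPrime p → V.frobeniusTrace p = 0 →
  ∀ (κ : ZpExtension ℚ p) (γ : absoluteGaloisGroup ℚ),
    κ.IsCyclotomic → κ.IsTopGenerator γ → γ ∈ galRange (K := ℚ) K₀ →
  ∀ (ε : ℤˣ) (D : TowerSignedSelmerDualData V κ K₀ ℚ_[p] γ ε),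
    Module.Finite (IwasawaAlgebra p) D.X ∧ Module.IsTorsion (IwasawaAlgebra p) D.X

namespace thm22_towerSignedSelmerDual_finite_torsion

/-- **Finite generation clause** of Thm. 2.2 on the whole dual, as a `Module.Finite` instance-producer
under the fact. [cite: Kobayashi2003, Thm. 2.2 (p. 5)] -/
theorem moduleFinite (h : thm22_towerSignedSelmerDual_finite_torsion)
    {p : ℕ} [Fact p.Prime] {K₀ : Type} [Field K₀] [NumberField K₀] [IsCyclotomicExtension {p} ℚ K₀]
    [(galRange (K := ℚ) K₀).Normal] {V : WeierstrassCurve ℚ} [V.IsElliptic] [V.IsGloballyMinimal]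
    (hp : p ≠ 2) (hgood : V.HasGoodReductionAtPrime p) (hap : V.frobeniusTrace p = 0)
    {κ : ZpExtension ℚ p} {γ : absoluteGaloisGroup ℚ} (hκ : κ.IsCyclotomic) (hγ : κ.IsTopGenerator γ)
    (hγ₀ : γ ∈ galRange (K := ℚ) K₀) {ε : ℤˣ} (D : TowerSignedSelmerDualData V κ K₀ ℚ_[p] γ ε) :
    Module.Finite (IwasawaAlgebra p) D.X :=
  (h p K₀ V hp hgood hap κ γ hκ hγ hγ₀ ε D).1

/-- **Torsion clause** of Thm. 2.2 on the whole dual. [cite: Kobayashi2003, Thm. 2.2 (p. 5) and §4 p. 8 l. 16] -/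
theorem isTorsion (h : thm22_towerSignedSelmerDual_finite_torsion)
    {p : ℕ} [Fact p.Prime] {K₀ : Type} [Field K₀] [NumberField K₀] [IsCyclotomicExtension {p} ℚ K₀]
    [(galRange (K := ℚ) K₀).Normal] {V : WeierstrassCurve ℚ} [V.IsElliptic] [V.IsGloballyMinimal]
    (hp : p ≠ 2) (hgood : V.HasGoodReductionAtPrime p) (hap : V.frobeniusTrace p = 0)
    {κ : ZpExtension ℚ p} {γ : absoluteGaloisGroup ℚ} (hκ : κ.IsCyclotomic) (hγ : κ.IsTopGenerator γ)
    (hγ₀ : γ ∈ galRange (K := ℚ) K₀) {ε : ℤˣ} (D : TowerSignedSelmerDualData V κ K₀ ℚ_[p] γ ε) :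
    Module.IsTorsion (IwasawaAlgebra p) D.X :=
  (h p K₀ V hp hgood hap κ γ hκ hγ hγ₀ ε D).2

end thm22_towerSignedSelmerDual_finite_torsion

end Literature.NumberTheory.EllipticCurves.Kobayashi2003

end
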